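import Summits.CriticalPhenomena.CardyFormulaZ2.Theorems.CardySusyWardDiscretisationFamilyExistsLegC2E
import Summits.CriticalPhenomena.CardyFormulaZ2.Theorems.CardySusyWardDiscretisationFamilyExistsLegC3E
import Summits.CriticalPhenomena.CardyFormulaZ2.Theorems.CardySusyWardDiscretisationFamilyExistsSelectionEast
import HarnessLib

/-!
# The east leg — helper for `DiscretisationFamilyExists` (stmt-CriticalPhenomena-9644)

Standard orientation.  `legData_east` combines the selection theorem (`select_east_of_deep`) with
the three leg constructors (`legData_C1`, `legData_C2E`, `legData_C3E`): given a deep block of inner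
cells (columns `j₀-1 … j₀+3`, rows `R-5 … R+1`), an exterior row `j₁` (cells `(j₀ … j₀+2, j₁)` not
inner), the first event of the central column not I-degenerate, a deep point `p` within `2δ` of the
centres of `(j₀ … j₀+2, R)` and a window containing the box `re ∈ [δ(j₀-4), δ(j₀+7)]`,
`im ∈ [δ(j₁-2), δ(R+2)]`, some leg exists: `Nonempty (LegData Ω δ a η p)`.
-/

noncomputable section

open Set Metric Complex
open Literature.Probability.LatticeModels Literature.Probability.Percolation
  Literature.Probability.LatticeModels.Mesh Literature.Probability.LatticeModels.DiscreteDobrushin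
  Literature.Topology.PlaneTopology

namespace Summit.CriticalPhenomena.CardyFormulaZ2.Theorems.DiscretisationFamilyExists

set_option maxHeartbeats 800000 in
/-- **The east leg exists.** See the module docstring. [folklore] -/
theorem legData_east {Ω : Set ℂ} {δ : ℝ} (hΩ : IsOpen Ω)
    (hJE : frontier Ω ⊆ closure (closure Ω)ᶜ) (hext : IsConnected (closure Ω)ᶜ)
    (hunb : ¬ Bornology.IsBounded (closure Ω)ᶜ) (hδ : 0 < δ) (hne : (frontier Ω).Nonempty)
    {j₀ R j₁ : ℤ} (hj₁ : j₁ + 5 ≤ R)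
    (hdeep : ∀ k j : ℤ, j₀ - 1 ≤ k → k ≤ j₀ + 3 → R - 5 ≤ j → j ≤ R + 1 →
      (⟨Ω, δ, ∅, ∅⟩ : DiscreteDobrushin).IsInnerFace ![k, j])
    (hbot : ∀ k : ℤ, j₀ ≤ k → k ≤ j₀ + 2 → ¬ (⟨Ω, δ, ∅, ∅⟩ : DiscreteDobrushin).IsInnerFace ![k, j₁])
    (hnotI : ∀ e₀ : ℤ, j₁ ≤ e₀ → e₀ + 5 ≤ R →
      (∀ j : ℤ, e₀ < j → j ≤ R → ((⟨Ω, δ, ∅, ∅⟩ : DiscreteDobrushin).IsInnerFace ![j₀, j] ∧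
        ¬ (((![j₀, j + 1] : Site 2) ∈ (⟨Ω, δ, ∅, ∅⟩ : DiscreteDobrushin).zdBoundary) ∧
          ((![j₀ + 1, j + 1] : Site 2) ∈ (⟨Ω, δ, ∅, ∅⟩ : DiscreteDobrushin).zdBoundary)))) →
      ¬ ((⟨Ω, δ, ∅, ∅⟩ : DiscreteDobrushin).IsInnerFace ![j₀, e₀] ∧
        ¬ (((![j₀, e₀ + 1] : Site 2) ∈ (⟨Ω, δ, ∅, ∅⟩ : DiscreteDobrushin).zdBoundary) ∧
          ((![j₀ + 1, e₀ + 1] : Site 2) ∈ (⟨Ω, δ, ∅, ∅⟩ : DiscreteDobrushin).zdBoundary))) →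
      ¬ (⟨Ω, δ, ∅, ∅⟩ : DiscreteDobrushin).IsInnerFace ![j₀, e₀] →
      ¬ (δ + infDist (meshPoint δ ![j₀, e₀ + 1]) (frontier Ω) ≤
        infDist (meshPoint δ ![j₀ + 1, e₀ + 1]) (frontier Ω)))
    {a p : ℂ} {η : ℝ} (hp : ∀ k : ℤ, j₀ ≤ k → k ≤ j₀ + 2 → dist (cellCenter δ k R) p ≤ 2 * δ)
    (hwin : ∀ z : ℂ, δ * (j₀ - 4) ≤ z.re → z.re ≤ δ * (j₀ + 7) → δ * (j₁ - 2) ≤ z.im → z.im ≤ δ * (R + 2) →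
      z ∈ ball a η) :
    Nonempty (LegData Ω δ a η p) := by
  obtain ⟨e₀, e₁, e₂, h0l, h0R, h1l, h1R, h2l, h2R, hsel⟩ :=
    select_east_of_deep (E := (⟨Ω, δ, ∅, ∅⟩ : DiscreteDobrushin)) hΩ hJE hext hunb hδ hne hj₁ hdeep hbot hnotI
  -- a non-inner cell in columns `j₀-1 … j₀+3` lies below row `R-5`
  have hlow : ∀ k j : ℤ, j₀ - 1 ≤ k → k ≤ j₀ + 3 → j ≤ R + 1 →
      ¬ (⟨Ω, δ, ∅, ∅⟩ : DiscreteDobrushin).IsInnerFace ![k, j] → j < R - 5 := by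
    intro k j hk1 hk2 hj h
    by_contra hcon; push Not at hcon
    exact h (hdeep k j hk1 hk2 hcon hj)
  -- a clean column through row `j₁` is impossible: its start is above `j₁`
  have hstart : ∀ (k y' : ℤ), j₀ ≤ k → k ≤ j₀ + 2 →
      (∀ j : ℤ, y' ≤ j → j ≤ R → (⟨Ω, δ, ∅, ∅⟩ : DiscreteDobrushin).IsInnerFace ![k, j]) → j₁ < y' := by
    intro k y' hk1 hk2 h
    by_contra hcon; push Not at hcon
    exact hbot k hk1 hk2 (h j₁ hcon (by omega))
  rcases hsel with ⟨y', hcol, hyR, hg, hnd⟩ | ⟨y', hcol, hyR, hg, hnd⟩ | ⟨y', hcol, hyR, hg, hnd⟩ |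
    ⟨h, hcol, heh, hhR, hQ, hside, hQ', hnd⟩ | ⟨h, hcol, heh, hhR, hQ, hside, hQ', hnd⟩ |
    ⟨h, hcol, heh, hhR, hN, hQ, hs1, hs2, hQ', hnd⟩ | ⟨h, hcol, heh, hhR, hN, hQ, hs1, hs2, hQ', hnd⟩
  · -- C1 at column `j₀`
    have hy1 := hstart j₀ y' le_rfl (by omega) fun j h1 h2 => (hcol j h1 h2).1
    have hy2 := hlow j₀ (y' - 1) (by omega) (by omega) (by omega) hg
    exact legData_C1 hΩ hJE hext hunb hδ (by omega) hcol hg hnd (hp j₀ le_rfl (by omega))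
      fun z h1 h2 h3 h4 => hwin z (by linarith) (by nlinarith) (by nlinarith [show (j₁ : ℝ) + 1 ≤ y' by exact_mod_cast hy1]) h4
  · -- C1 at column `j₀+1`
    have hy1 := hstart (j₀ + 1) y' (by omega) (by omega) fun j h1 h2 => (hcol j h1 h2).1
    have hy2 := hlow (j₀ + 1) (y' - 1) (by omega) (by omega) (by omega) hg
    rw [show j₀ + 2 = j₀ + 1 + 1 by ring] at hcol hnd
    exact legData_C1 hΩ hJE hext hunb hδ (by omega) hcol hg hnd (hp (j₀ + 1) (by omega) (by omega))
      fun z h1 h2 h3 h4 => hwin z (by push_cast at h1; linarith) (by push_cast at h2; nlinarith)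
        (by nlinarith [show (j₁ : ℝ) + 1 ≤ y' by exact_mod_cast hy1]) h4
  · -- C1 at column `j₀+2`
    have hy1 := hstart (j₀ + 2) y' (by omega) le_rfl fun j h1 h2 => (hcol j h1 h2).1
    have hy2 := hlow (j₀ + 2) (y' - 1) (by omega) (by omega) (by omega) hg
    rw [show j₀ + 3 = j₀ + 2 + 1 by ring] at hcol hnd
    exact legData_C1 hΩ hJE hext hunb hδ (by omega) hcol hg hnd (hp (j₀ + 2) (by omega) le_rfl)
      fun z h1 h2 h3 h4 => hwin z (by push_cast at h1; linarith) (by push_cast at h2; nlinarith)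
        (by nlinarith [show (j₁ : ℝ) + 1 ≤ y' by exact_mod_cast hy1]) h4
  · -- C2E from column `j₀`
    have hh := hlow (j₀ + 2) h (by omega) (by omega) (by omega) hQ'
    exact legData_C2E hΩ hJE hext hunb hδ (by omega) heh hcol hQ hside hQ' hnd (hp j₀ le_rfl (by omega))
      fun z h1 h2 h3 h4 => hwin z (by linarith) (by nlinarith)
        (by nlinarith [show (j₁ : ℝ) + 1 ≤ h by exact_mod_cast (show j₁ + 1 ≤ h by omega)]) h4
  · -- C2E from column `j₀+1`
    have hh := hlow (j₀ + 3) h (by omega) le_rfl (by omega) hQ'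
    rw [show j₀ + 2 = j₀ + 1 + 1 by ring] at hcol hQ hside
    rw [show j₀ + 3 = j₀ + 1 + 2 by ring] at hQ' hnd
    exact legData_C2E hΩ hJE hext hunb hδ (by omega) heh hcol hQ hside hQ' hnd (hp (j₀ + 1) (by omega) (by omega))
      fun z h1 h2 h3 h4 => hwin z (by push_cast at h1; linarith) (by push_cast at h2; nlinarith)
        (by nlinarith [show (j₁ : ℝ) + 1 ≤ h by exact_mod_cast (show j₁ + 1 ≤ h by omega)]) h4
  · -- C3E from column `j₀+1`
    have hh := hlow (j₀ + 2) (h - 1) (by omega) (by omega) (by omega) hQ'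
    rw [show j₀ + 2 = j₀ + 1 + 1 by ring] at hcol hN hQ hs1 hs2 hQ' hnd
    rw [show j₀ + 3 = j₀ + 1 + 2 by ring] at hs2 hnd
    exact legData_C3E hΩ hJE hext hunb hδ (by omega) heh hcol hN hQ hs1 hs2 hQ' hnd (hp (j₀ + 1) (by omega) (by omega))
      fun z h1 h2 h3 h4 => hwin z (by push_cast at h1; linarith) (by push_cast at h2; nlinarith)
        (by nlinarith [show (j₁ : ℝ) ≤ h by exact_mod_cast (show j₁ ≤ h by omega)]) h4
  · -- C3E from column `j₀+2`
    have hh := hlow (j₀ + 3) (h - 1) (by omega) le_rfl (by omega) hQ'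
    rw [show j₀ + 3 = j₀ + 2 + 1 by ring] at hcol hN hQ hs1 hs2 hQ' hnd
    rw [show j₀ + 4 = j₀ + 2 + 2 by ring] at hs2 hnd
    exact legData_C3E hΩ hJE hext hunb hδ (by omega) heh hcol hN hQ hs1 hs2 hQ' hnd (hp (j₀ + 2) (by omega) le_rfl)
      fun z h1 h2 h3 h4 => hwin z (by push_cast at h1; linarith) (by push_cast at h2; nlinarith)
        (by nlinarith [show (j₁ : ℝ) ≤ h by exact_mod_cast (show j₁ ≤ h by omega)]) h4

end Summit.CriticalPhenomena.CardyFormulaZ2.Theorems.DiscretisationFamilyExists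

end
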